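import Literature.MathematicalPhysics.QuantumFieldTheory.Federbush1986.ModeAnalyticityLatticeSums

/-!
# Federbush–Williamson, *A phase cell approach to Yang–Mills theory. II. Analysis of a mode* (J. Math. Phys. **28**
# (1987) 1416–1419) [FederbushWilliamson1987PhaseCellII] — the light-cone limit behind the failure of (6.12):
# `(D₂ − D₁)(t(1, i, 0, 0))/t² → 2Σ_{N≠0}(2πN)⁻⁴ > 0`

statement-level skeleton of published theorems with citation tags; proofs where landed; nothing here is a claim about
the Yang–Mills mass gap

PDF held: Deep-Blue scan `run/shared/lean/pub/pub-balaban/t4/b2b-balaban-t4-lit2/pdf/fedwill1987-jmp28-II.pdf`, page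
renders `…/b2b-balaban-t4-lit2/g7/fw1987II/fedwill1987-jmp28-II-p001…p004-x2.png` (read as images this session).

WHAT IS REPRODUCED (cell `lit-balaban`, Phase-2 proof seat p04 gen 5, SKELETON row **F2.Thm3.1**; HOME
`run/shared/lean/pub/lit-balaban/lit-balaban-p04/`; GAPS.md §G-F2-01).  Second support file of the kernel refutation of
Theorem 3.1 p. 1417.  The printed proof (§VI p. 1418) needs (6.12) *"g/p² is analytic"* for the `g` of (6.14),
`g = Σ_k (p_k²/p²)[∏_{j≠k}(1 + δ_j) − 1]`, `δ_j = p²D_j` (sibling `ModeAnalyticityLatticeSums`).  On the complex light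
cone `p² = 0` one has `g = Σ_k p_k² Σ_{j≠k} D_j`, and along the cone points `p = t·v`, `v = (1, i, 0, 0)` (print's
indices 1, 2; Lean's `0`, `1`) this is `t²(D₂ − D₁)(tv)` (Lean: `D 1 − D 0`).  PROVED here (kernel, no `sorry`):
**`tendsto_cone`** — `(D 1 − D 0)(t·v)/t² → ℓ` as `t → 0`, `t ≠ 0`, where
`ℓ = Σ_{n≠0} L(n) = 2Σ_{N∈ℤ∖0}(2πN)⁻⁴` (`ell`, `Lcoef`: only the lattice vectors `N e₁`, `N e₂` contribute in the
limit, each with `(2πN)⁻⁴`; dominated convergence `tendsto_tsum_of_dominated_convergence` with the summable majorant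
`u(n)/12` of the sibling, from the `t²`-extraction `‖termD₁ − termD₀‖(t·v) ≤ t²·u(n)/12`, `norm_termD_sub_le`), and
**`ell_pos`** — `ℓ > 0`.  Numerically `ℓ = 4ζ(4)/(2π)⁴ = 1/360` (not needed and not proved).  Consequence drawn in
`ModeAnalyticityThm31Refutation`: `g(t·v) = t⁴·((D₂−D₁)(tv)/t²)` with a non-zero limit of the last factor, so `p²`
does NOT divide `g` near `0` — (6.12) fails — and the mode `A^N_1` has a pole along the cone.
D-0026: no named fact; `def`s are the explicit objects `v`, `pv`, `Lcoef`, `ell`, `sTerm`; every `Prop` is proved.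
-/

noncomputable section

namespace Literature.MathematicalPhysics.QuantumFieldTheory.Federbush1986

namespace ModeAnalyticityConeLimit

open ModeAnalyticity ModeAnalyticityLatticeSums Complex Filter Topology Finset Metric
open scoped BigOperators Real

/-! ## The cone direction `v = (1, i, 0, 0)` and the points `t·v` -/

/-- The light-cone direction `v = (1, i, 0, 0)`: `Σ_j v_j² = 0`. [cite: FederbushWilliamson1987PhaseCellII, §II p. 1417
(«a singularity … on the surface p² = 0»)] -/
def v : Momentum := ![1, I, 0, 0]

/-- The cone points `p = t·v`, `t` real. [cite: FederbushWilliamson1987PhaseCellII, §II p. 1417] -/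
def pv (t : ℝ) : Momentum := fun i => (t : ℂ) * v i

/-- (plumbing) [cite: FederbushWilliamson1987PhaseCellII, §II p. 1417] -/
@[simp] theorem v_zero : v 0 = 1 := rfl
/-- (plumbing) [cite: FederbushWilliamson1987PhaseCellII, §II p. 1417] -/
@[simp] theorem v_one : v 1 = I := rfl
/-- (plumbing) [cite: FederbushWilliamson1987PhaseCellII, §II p. 1417] -/
@[simp] theorem v_two : v 2 = 0 := rfl
/-- (plumbing) [cite: FederbushWilliamson1987PhaseCellII, §II p. 1417] -/
@[simp] theorem v_three : v 3 = 0 := rfl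

/-- (plumbing) [cite: FederbushWilliamson1987PhaseCellII, §II p. 1417] -/
@[simp] theorem pv_zero (t : ℝ) : pv t 0 = t := by simp [pv]
/-- (plumbing) [cite: FederbushWilliamson1987PhaseCellII, §II p. 1417] -/
@[simp] theorem pv_one (t : ℝ) : pv t 1 = t * I := by simp [pv]
/-- (plumbing) [cite: FederbushWilliamson1987PhaseCellII, §II p. 1417] -/
@[simp] theorem pv_two (t : ℝ) : pv t 2 = 0 := by simp [pv]
/-- (plumbing) [cite: FederbushWilliamson1987PhaseCellII, §II p. 1417] -/
@[simp] theorem pv_three (t : ℝ) : pv t 3 = 0 := by simp [pv]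

/-- `t·v` lies on the complex light cone: `Σ_j (t v_j)² = t² + (it)² = 0`. [cite: FederbushWilliamson1987PhaseCellII,
§II p. 1417] -/
theorem csq_pv (t : ℝ) : csq (pv t) = 0 := by
  simp [csq, Fin.sum_univ_four, mul_pow, Complex.I_sq]

/-- (plumbing) [cite: FederbushWilliamson1987PhaseCellII, §II p. 1417] -/
theorem norm_v_le (i : Fin 4) : ‖v i‖ ≤ 1 := by
  fin_cases i <;> simp [v]

/-- (plumbing) [cite: FederbushWilliamson1987PhaseCellII, §II p. 1417] -/
theorem norm_pv_apply_le (t : ℝ) (i : Fin 4) : ‖pv t i‖ ≤ |t| := by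
  unfold pv
  rw [norm_mul, Complex.norm_real, Real.norm_eq_abs]
  exact mul_le_of_le_one_right (abs_nonneg t) (norm_v_le i)

/-- `t·v ∈ U` (the ball `‖p‖ < 1/2`) for `|t| < 1/2`. [cite: FederbushWilliamson1987PhaseCellII, §V p. 1418] -/
theorem pv_mem_U {t : ℝ} (ht : |t| < 1 / 2) : pv t ∈ U := by
  have h : ‖pv t‖ ≤ |t| := (pi_norm_le_iff_of_nonneg (abs_nonneg t)).mpr fun i => norm_pv_apply_le t i
  simpa [U] using h.trans_lt ht

/-- (plumbing) [cite: FederbushWilliamson1987PhaseCellII, (6.6)–(6.7) p. 1418] -/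
theorem shift_pv (t : ℝ) (n : Idx) (i : Fin 4) : shift (pv t) n i = (t : ℂ) * v i + 2 * π * (n i : ℂ) := rfl

/-! ## The limit coefficients and `ℓ` -/

/-- The limit of the `n`-th term: `(2πN)⁻⁴` for `n = N e₁` or `n = N e₂` (print's axes 1, 2), `0` otherwise.
[cite: FederbushWilliamson1987PhaseCellII, (6.6), (6.14) p. 1418] -/
def Lcoef (n : Idx) : ℝ :=
  if n 1 = 0 ∧ n 2 = 0 ∧ n 3 = 0 then 1 / (2 * π * (n 0 : ℝ)) ^ 4
  else if n 0 = 0 ∧ n 2 = 0 ∧ n 3 = 0 then 1 / (2 * π * (n 1 : ℝ)) ^ 4 else 0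

/-- `ℓ = Σ_{n ≠ 0} L(n) = 2Σ_{N≠0}(2πN)⁻⁴` (`= 1/360`). [cite: FederbushWilliamson1987PhaseCellII, (6.14) p. 1418] -/
def ell : ℝ := ∑' n : NZ, Lcoef n.1

/-- (plumbing) [cite: FederbushWilliamson1987PhaseCellII, (6.14) p. 1418] -/
theorem Lcoef_nonneg (n : Idx) : 0 ≤ Lcoef n := by
  unfold Lcoef; split_ifs <;> positivity

/-- `(2πm)⁻⁴ ≤ b(m)`. [folklore] -/
private theorem inv_fourth_le_b {m : ℤ} : 1 / (2 * π * (m : ℝ)) ^ 4 ≤ b m := by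
  by_cases hm : m = 0
  · simp [hm, b_zero]
  · rw [b_of_ne hm]
    have h1 : (1 : ℝ) ≤ (m : ℝ) ^ 2 := by
      have := one_le_sq_iff_one_le_abs (m : ℝ) |>.mpr (by rw [← Int.cast_abs]; exact_mod_cast Int.one_le_abs hm)
      exact this
    have hπ : 3 < π := Real.pi_gt_three
    have hπ2 : 9 < π ^ 2 := by nlinarith
    have hπ4 : 81 < π ^ 4 := by nlinarith [hπ2]
    have hm2 : (m : ℝ) ^ 2 ≤ ((m : ℝ) ^ 2) ^ 2 := by nlinarith [h1]
    rw [div_le_div_iff₀ (by positivity) (by positivity), one_mul, one_mul]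
    have e : (2 * π * (m : ℝ)) ^ 4 = 16 * π ^ 4 * ((m : ℝ) ^ 2) ^ 2 := by ring
    rw [e]
    nlinarith [hm2, hπ4, h1]

/-- `L(n) ≤ u(n)` (so `L` is summable). [cite: FederbushWilliamson1987PhaseCellII, (6.8), (6.14) p. 1418] -/
theorem Lcoef_le_u (n : Idx) : Lcoef n ≤ u n := by
  unfold Lcoef
  split_ifs with h1 h2
  · have hu : u n = b (n 0) := by
      simp [u, Fin.prod_univ_four, h1.1, h1.2.1, h1.2.2, b_zero]
    rw [hu]; exact inv_fourth_le_b
  · have hu : u n = b (n 1) := by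
      simp [u, Fin.prod_univ_four, h2.1, h2.2.1, h2.2.2, b_zero]
    rw [hu]; exact inv_fourth_le_b
  · exact u_nonneg n

/-- (plumbing) [cite: FederbushWilliamson1987PhaseCellII, (6.14) p. 1418] -/
theorem summable_Lcoef : Summable fun n : NZ => Lcoef n.1 :=
  Summable.of_nonneg_of_le (fun n => Lcoef_nonneg n.1) (fun n => Lcoef_le_u n.1) summable_u_NZ

/-- The unit lattice vector `e₁` (Lean axis `0`). [cite: FederbushWilliamson1987PhaseCellII, (6.6) p. 1418] -/
def e0 : Idx := Pi.single 0 1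

/-- (plumbing) [cite: FederbushWilliamson1987PhaseCellII, (6.6) p. 1418] -/
theorem e0_ne_zero : e0 ≠ 0 := by
  intro h; have := congr_fun h 0; simp [e0] at this

/-- (plumbing) [cite: FederbushWilliamson1987PhaseCellII, (6.14) p. 1418] -/
theorem Lcoef_e0 : Lcoef e0 = 1 / (2 * π) ^ 4 := by
  simp [Lcoef, e0]

/-- **`ℓ > 0`.** [cite: FederbushWilliamson1987PhaseCellII, (6.14) p. 1418] -/
theorem ell_pos : 0 < ell := by
  unfold ell
  refine summable_Lcoef.tsum_pos (fun n => Lcoef_nonneg n.1) ⟨e0, e0_ne_zero⟩ ?_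
  simp only [Lcoef_e0]; positivity

/-- (plumbing) [cite: FederbushWilliamson1987PhaseCellII, (6.14) p. 1418] -/
theorem ell_ne_zero : (ell : ℂ) ≠ 0 := by exact_mod_cast ell_pos.ne'

/-! ## The terms `s_n(t) = (termD₁ − termD₀)(t·v)/t²`, their domination and their limits -/

/-- `s_n(t) = (termD 1 n (tv) − termD 0 n (tv))/t²`. [cite: FederbushWilliamson1987PhaseCellII, (6.6), (6.14) p. 1418] -/
def sTerm (n : Idx) (t : ℝ) : ℂ := (termD 1 n (pv t) - termD 0 n (pv t)) / (t : ℂ) ^ 2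

/-- (plumbing) [cite: FederbushWilliamson1987PhaseCellII, (6.6) p. 1418] -/
theorem ratio_pv_two_of_ne (t : ℝ) {n : Idx} (h : n 2 ≠ 0) : ratio n (pv t) 2 = 0 := by
  rw [ratio_of_ne h]; simp

/-- (plumbing) [cite: FederbushWilliamson1987PhaseCellII, (6.6) p. 1418] -/
theorem ratio_pv_three_of_ne (t : ℝ) {n : Idx} (h : n 3 ≠ 0) : ratio n (pv t) 3 = 0 := by
  rw [ratio_of_ne h]; simp

/-- The terms with `n₃ ≠ 0` or `n₄ ≠ 0` vanish identically on the cone points. [cite: FederbushWilliamson1987PhaseCellII,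
(6.6) p. 1418] -/
theorem termD_pv_eq_zero_of_ne (t : ℝ) (j : Fin 4) {n : Idx} (h : n 2 ≠ 0 ∨ n 3 ≠ 0) : termD j n (pv t) = 0 := by
  unfold termD
  have : ∏ i, ratio n (pv t) i = 0 := by
    rw [Fin.prod_univ_four]
    rcases h with h | h
    · simp [ratio_pv_two_of_ne t h]
    · simp [ratio_pv_three_of_ne t h]
  simp [this]

/-- (plumbing: `‖ratio_k(t·v)‖ ≤ t²·b(n_k)` for the cone axes `k = 0, 1`)
[cite: FederbushWilliamson1987PhaseCellII, (6.8) p. 1418] -/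
theorem norm_ratio_pv_le_sq {t : ℝ} (ht : |t| < 1 / 2) (n : Idx) {k : Fin 4} (hk : k = 0 ∨ k = 1) (hnk : n k ≠ 0) :
    ‖ratio n (pv t) k‖ ≤ t ^ 2 * b (n k) := by
  have h := norm_ratio_le (pv_mem_U ht) hnk
  have hn : ‖pv t k‖ = |t| := by
    rcases hk with rfl | rfl <;> simp [Complex.norm_real]
  rw [hn, sq_abs] at h
  rw [b_of_ne hnk]
  simpa [div_eq_mul_inv] using h

/-- **The `t²`-extraction**: `‖termD₁(n, tv) − termD₀(n, tv)‖ ≤ t²·u(n)/12` for `n ≠ 0`, `|t| < 1/2`.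
[cite: FederbushWilliamson1987PhaseCellII, (6.8) p. 1418] -/
theorem norm_termD_sub_le {t : ℝ} (ht : |t| < 1 / 2) {n : Idx} (hn : n ≠ 0) :
    ‖termD 1 n (pv t) - termD 0 n (pv t)‖ ≤ t ^ 2 * u n / 12 := by
  have hp := pv_mem_U ht
  by_cases h01 : n 0 = 0 ∧ n 1 = 0
  · have e : termD 1 n (pv t) = termD 0 n (pv t) := by
      simp [termD, ratio_of_eq h01.1, ratio_of_eq h01.2]
    rw [e, sub_self, norm_zero]; have := u_nonneg n; positivity
  · -- some cone-axis component of `n` is non-zero: the product of ratios carries a factor `t²`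
    have hprod : ‖∏ i, ratio n (pv t) i‖ ≤ t ^ 2 * u n := by
      obtain ⟨k, hk, hnk⟩ : ∃ k : Fin 4, (k = 0 ∨ k = 1) ∧ n k ≠ 0 := by
        rcases not_and_or.mp h01 with h0 | h1
        · exact ⟨0, Or.inl rfl, h0⟩
        · exact ⟨1, Or.inr rfl, h1⟩
      let c : Fin 4 → ℝ := fun i => if i = k then t ^ 2 * b (n i) else b (n i)
      have hle : ∀ i, ‖ratio n (pv t) i‖ ≤ c i := by
        intro i
        by_cases hik : i = k
        · subst hik; simp only [c, if_true]; exact norm_ratio_pv_le_sq ht n hk hnk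
        · simp only [c, hik, if_false]; exact norm_ratio_le_b hp n i
      have hc : ∏ i, c i = t ^ 2 * u n := by
        rcases hk with rfl | rfl <;> simp [c, u, Fin.prod_univ_four] <;> ring
      calc ‖∏ i, ratio n (pv t) i‖ = ∏ i, ‖ratio n (pv t) i‖ := norm_prod _ _
        _ ≤ ∏ i, c i := Finset.prod_le_prod (fun i _ => norm_nonneg _) fun i _ => hle i
        _ = t ^ 2 * u n := hc
    have hdiff : ‖ratio n (pv t) 1 - ratio n (pv t) 0‖ ≤ 2 := by
      calc ‖ratio n (pv t) 1 - ratio n (pv t) 0‖ ≤ ‖ratio n (pv t) 1‖ + ‖ratio n (pv t) 0‖ := norm_sub_le _ _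
        _ ≤ 1 + 1 := add_le_add (norm_ratio_le_one hp n 1) (norm_ratio_le_one hp n 0)
        _ = 2 := by norm_num
    have hc := norm_csq_shift_ge hp hn
    have e : termD 1 n (pv t) - termD 0 n (pv t)
        = (∏ i, ratio n (pv t) i) * (ratio n (pv t) 1 - ratio n (pv t) 0) / csq (shift (pv t) n) := by
      unfold termD; ring
    rw [e, norm_div, norm_mul, div_le_div_iff₀ (by linarith) (by norm_num)]
    have hu := u_nonneg n
    have := mul_le_mul hprod hdiff (norm_nonneg _) (by positivity)
    nlinarith [norm_nonneg (∏ i, ratio n (pv t) i), norm_nonneg (ratio n (pv t) 1 - ratio n (pv t) 0)]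

/-- (plumbing) the punctured neighbourhood used for dominated convergence. [cite: FederbushWilliamson1987PhaseCellII,
§V p. 1418] -/
theorem eventually_small : ∀ᶠ t : ℝ in 𝓝[≠] 0, t ≠ 0 ∧ |t| < 1 / 2 := by
  have h1 : ∀ᶠ t : ℝ in 𝓝[≠] 0, t ≠ 0 := eventually_mem_nhdsWithin
  have h2 : ∀ᶠ t : ℝ in 𝓝[≠] 0, |t| < 1 / 2 := by
    have : ∀ᶠ t : ℝ in 𝓝 0, |t| < 1 / 2 := by
      have := Metric.ball_mem_nhds (0 : ℝ) (by norm_num : (0:ℝ) < 1 / 2)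
      filter_upwards [this] with t ht
      simpa [Real.dist_eq] using ht
    exact this.filter_mono nhdsWithin_le_nhds
  exact h1.and h2

/-- THE DOMINATION `‖s_n(t)‖ ≤ u(n)/12` on `0 < |t| < 1/2`. [cite: FederbushWilliamson1987PhaseCellII, (6.8) p. 1418] -/
theorem norm_sTerm_le {t : ℝ} (ht0 : t ≠ 0) (ht : |t| < 1 / 2) {n : Idx} (hn : n ≠ 0) :
    ‖sTerm n t‖ ≤ u n / 12 := by
  unfold sTerm
  rw [norm_div, norm_pow, Complex.norm_real, Real.norm_eq_abs, sq_abs]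
  have ht2 : 0 < t ^ 2 := by positivity
  rw [div_le_iff₀ ht2]
  have := norm_termD_sub_le ht hn
  linarith

/-! ### Pointwise limits of `s_n(t)` -/

/-- Case `n₃ ≠ 0 ∨ n₄ ≠ 0`: `s_n ≡ 0`. [cite: FederbushWilliamson1987PhaseCellII, (6.6) p. 1418] -/
theorem sTerm_eq_zero_of_ne {n : Idx} (h : n 2 ≠ 0 ∨ n 3 ≠ 0) (t : ℝ) : sTerm n t = 0 := by
  simp [sTerm, termD_pv_eq_zero_of_ne t 1 h, termD_pv_eq_zero_of_ne t 0 h]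

/-- (plumbing) `L(n) = 0` unless `n` is on the axis `e₁` or `e₂`. [cite: FederbushWilliamson1987PhaseCellII, (6.14) p. 1418] -/
theorem Lcoef_eq_zero_of_ne {n : Idx} (h : n 2 ≠ 0 ∨ n 3 ≠ 0) : Lcoef n = 0 := by
  unfold Lcoef
  rcases h with h | h <;> simp [h]

/-- (plumbing) [cite: FederbushWilliamson1987PhaseCellII, (6.14) p. 1418] -/
theorem Lcoef_eq_zero_of_both {n : Idx} (h0 : n 0 ≠ 0) (h1 : n 1 ≠ 0) : Lcoef n = 0 := by
  unfold Lcoef; simp [h0, h1]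

/-- Case both cone components non-zero: `‖s_n(t)‖ ≤ t²/12 → 0`. [cite: FederbushWilliamson1987PhaseCellII, (6.6) p. 1418] -/
theorem norm_sTerm_le_sq {t : ℝ} (ht0 : t ≠ 0) (ht : |t| < 1 / 2) {n : Idx} (h23 : n 2 = 0 ∧ n 3 = 0)
    (h0 : n 0 ≠ 0) (h1 : n 1 ≠ 0) : ‖sTerm n t‖ ≤ t ^ 2 / 12 := by
  have hp := pv_mem_U ht
  have hn : n ≠ 0 := fun h => h0 (by simp [h])
  have c0 := norm_ratio_pv_le_sq ht n (Or.inl rfl) h0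
  have c1 := norm_ratio_pv_le_sq ht n (Or.inr rfl) h1
  have hb0 := b_le_one (n 0)
  have hb1 := b_le_one (n 1)
  have hprod : ‖∏ i, ratio n (pv t) i‖ ≤ t ^ 2 * t ^ 2 := by
    rw [Fin.prod_univ_four, ratio_of_eq h23.1, ratio_of_eq h23.2, mul_one, mul_one, norm_mul]
    have ht2 : 0 ≤ t ^ 2 := sq_nonneg t
    calc ‖ratio n (pv t) 0‖ * ‖ratio n (pv t) 1‖ ≤ (t ^ 2 * b (n 0)) * (t ^ 2 * b (n 1)) :=
          mul_le_mul c0 c1 (norm_nonneg _) (mul_nonneg ht2 (b_nonneg _))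
      _ ≤ (t ^ 2 * 1) * (t ^ 2 * 1) :=
          mul_le_mul (mul_le_mul_of_nonneg_left hb0 ht2) (mul_le_mul_of_nonneg_left hb1 ht2)
            (mul_nonneg ht2 (b_nonneg _)) (by positivity)
      _ = t ^ 2 * t ^ 2 := by ring
  have hdiff : ‖ratio n (pv t) 1 - ratio n (pv t) 0‖ ≤ 2 := by
    calc ‖ratio n (pv t) 1 - ratio n (pv t) 0‖ ≤ ‖ratio n (pv t) 1‖ + ‖ratio n (pv t) 0‖ := norm_sub_le _ _
      _ ≤ 1 + 1 := add_le_add (norm_ratio_le_one hp n 1) (norm_ratio_le_one hp n 0)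
      _ = 2 := by norm_num
  have hc := norm_csq_shift_ge hp hn
  have e : sTerm n t
      = (∏ i, ratio n (pv t) i) * (ratio n (pv t) 1 - ratio n (pv t) 0) / csq (shift (pv t) n) / (t : ℂ) ^ 2 := by
    unfold sTerm termD; ring
  rw [e, norm_div, norm_div, norm_mul, norm_pow, Complex.norm_real, Real.norm_eq_abs, sq_abs]
  have ht2 : 0 < t ^ 2 := by positivity
  rw [div_div, div_le_div_iff₀ (by positivity) (by norm_num)]
  have := mul_le_mul hprod hdiff (norm_nonneg _) (by positivity)
  nlinarith [norm_nonneg (∏ i, ratio n (pv t) i), norm_nonneg (ratio n (pv t) 1 - ratio n (pv t) 0)]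

/-- Case both cone components non-zero: `s_n(t) → 0 = L(n)`. [cite: FederbushWilliamson1987PhaseCellII, (6.6) p. 1418] -/
theorem tendsto_sTerm_both {n : Idx} (h23 : n 2 = 0 ∧ n 3 = 0) (h0 : n 0 ≠ 0) (h1 : n 1 ≠ 0) :
    Tendsto (sTerm n) (𝓝[≠] 0) (𝓝 (Lcoef n : ℂ)) := by
  rw [Lcoef_eq_zero_of_both h0 h1, Complex.ofReal_zero]
  refine squeeze_zero_norm' (a := fun t : ℝ => t ^ 2 / 12) ?_ ?_
  · filter_upwards [eventually_small] with t ht using norm_sTerm_le_sq ht.1 ht.2 h23 h0 h1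
  · have : Tendsto (fun t : ℝ => t ^ 2 / 12) (𝓝 0) (𝓝 0) := by
      have h := ((continuous_pow 2).div_const (12:ℝ)).tendsto (0:ℝ)
      simpa using h
    exact this.mono_left nhdsWithin_le_nhds

/-- The explicit function of case `n = N e₁`: `s_n(t) = φ_N(t)` for `t ≠ 0`.
[cite: FederbushWilliamson1987PhaseCellII, (6.6) p. 1418] -/
def phiA (N : ℤ) (t : ℝ) : ℂ :=
  ((t + 2 * π * (N : ℂ)) ^ 2)⁻¹ * (1 - (t : ℂ) ^ 2 / (t + 2 * π * (N : ℂ)) ^ 2) /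
    ((t + 2 * π * (N : ℂ)) ^ 2 - (t : ℂ) ^ 2)

/-- The explicit function of case `n = N e₂`: `s_n(t) = ψ_N(t)` for `t ≠ 0`.
[cite: FederbushWilliamson1987PhaseCellII, (6.6) p. 1418] -/
def phiB (N : ℤ) (t : ℝ) : ℂ :=
  (-((t * I + 2 * π * (N : ℂ)) ^ 2)⁻¹) * (-(t : ℂ) ^ 2 / (t * I + 2 * π * (N : ℂ)) ^ 2 - 1) /
    ((t : ℂ) ^ 2 + (t * I + 2 * π * (N : ℂ)) ^ 2)

/-- `2πN ≠ 0` for `N ≠ 0`. [folklore] -/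
private theorem twoPiN_ne_zero {N : ℤ} (hN : N ≠ 0) : (2 * π * (N : ℂ)) ≠ 0 := by
  have : (N : ℂ) ≠ 0 := by exact_mod_cast hN
  have hπ : (π : ℂ) ≠ 0 := by exact_mod_cast Real.pi_ne_zero
  exact mul_ne_zero (mul_ne_zero two_ne_zero hπ) this

/-- (plumbing) continuity of `φ_N` at `0` and its value `(2πN)⁻⁴`. [cite: FederbushWilliamson1987PhaseCellII, (6.6) p. 1418] -/
theorem continuousAt_phiA {N : ℤ} (hN : N ≠ 0) : ContinuousAt (phiA N) 0 := by
  have hc : Continuous fun t : ℝ => (t : ℂ) := Complex.continuous_ofReal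
  have hd : Continuous fun t : ℝ => ((t : ℂ) + 2 * π * (N : ℂ)) := hc.add continuous_const
  have h0 : ((0 : ℝ) : ℂ) + 2 * π * (N : ℂ) ≠ 0 := by simpa using twoPiN_ne_zero hN
  unfold phiA
  refine ContinuousAt.div ?_ ?_ ?_
  · refine ContinuousAt.mul ?_ ?_
    · exact ((hd.pow 2).continuousAt).inv₀ (pow_ne_zero _ h0)
    · exact continuousAt_const.sub (((hc.pow 2).continuousAt).div ((hd.pow 2).continuousAt) (pow_ne_zero _ h0))
  · exact ((hd.pow 2).sub (hc.pow 2)).continuousAt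
  · simp only [Complex.ofReal_zero, zero_add, ne_eq, zero_pow, OfNat.ofNat_ne_zero, not_false_eq_true, sub_zero]
    exact pow_ne_zero _ (twoPiN_ne_zero hN)

/-- (plumbing) [cite: FederbushWilliamson1987PhaseCellII, (6.6) p. 1418] -/
theorem phiA_zero {N : ℤ} (hN : N ≠ 0) : phiA N 0 = ((1 / (2 * π * (N : ℝ)) ^ 4 : ℝ) : ℂ) := by
  have h := twoPiN_ne_zero hN
  unfold phiA
  push_cast
  field_simp
  ring

/-- (plumbing) continuity of `ψ_N` at `0`. [cite: FederbushWilliamson1987PhaseCellII, (6.6) p. 1418] -/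
theorem continuousAt_phiB {N : ℤ} (hN : N ≠ 0) : ContinuousAt (phiB N) 0 := by
  have hc : Continuous fun t : ℝ => (t : ℂ) := Complex.continuous_ofReal
  have hd : Continuous fun t : ℝ => ((t : ℂ) * I + 2 * π * (N : ℂ)) := (hc.mul continuous_const).add continuous_const
  have h0 : ((0 : ℝ) : ℂ) * I + 2 * π * (N : ℂ) ≠ 0 := by simpa using twoPiN_ne_zero hN
  unfold phiB
  refine ContinuousAt.div ?_ ?_ ?_
  · refine ContinuousAt.mul ?_ ?_
    · exact (((hd.pow 2).continuousAt).inv₀ (pow_ne_zero _ h0)).neg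
    · exact ((((hc.pow 2).neg).continuousAt).div ((hd.pow 2).continuousAt) (pow_ne_zero _ h0)).sub
        continuousAt_const
  · exact ((hc.pow 2).add (hd.pow 2)).continuousAt
  · simp only [Complex.ofReal_zero, zero_mul, zero_add, ne_eq, zero_pow, OfNat.ofNat_ne_zero, not_false_eq_true]
    exact pow_ne_zero _ (twoPiN_ne_zero hN)

/-- (plumbing) [cite: FederbushWilliamson1987PhaseCellII, (6.6) p. 1418] -/
theorem phiB_zero {N : ℤ} (hN : N ≠ 0) : phiB N 0 = ((1 / (2 * π * (N : ℝ)) ^ 4 : ℝ) : ℂ) := by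
  have h := twoPiN_ne_zero hN
  unfold phiB
  push_cast
  field_simp
  ring

/-- Case `n = N e₁`: `s_n(t) = φ_N(t)` for `0 < |t| < 1/2`. [cite: FederbushWilliamson1987PhaseCellII, (6.6) p. 1418] -/
theorem sTerm_eq_phiA {t : ℝ} (ht0 : t ≠ 0) (ht : |t| < 1 / 2) {n : Idx} (h0 : n 0 ≠ 0)
    (h1 : n 1 = 0) (h2 : n 2 = 0) (h3 : n 3 = 0) : sTerm n t = phiA (n 0) t := by
  have hp := pv_mem_U ht
  have hs0 : shift (pv t) n 0 = (t : ℂ) + 2 * π * (n 0 : ℂ) := by simp [shift_pv]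
  have hsh : shift (pv t) n 0 ≠ 0 := shift_ne_zero hp h0
  rw [hs0] at hsh
  have hτ : (t : ℂ) ≠ 0 := by exact_mod_cast ht0
  have hcsq : csq (shift (pv t) n) = ((t : ℂ) + 2 * π * (n 0 : ℂ)) ^ 2 - (t : ℂ) ^ 2 := by
    simp [csq, Fin.sum_univ_four, shift_pv, h1, h2, h3, mul_pow, Complex.I_sq]; ring
  have hcsq_ne : csq (shift (pv t) n) ≠ 0 := csq_shift_ne_zero hp (fun h => h0 (by simp [h]))
  rw [hcsq] at hcsq_ne
  unfold sTerm termD phiA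
  rw [Fin.prod_univ_four, ratio_of_eq h1, ratio_of_eq h2, ratio_of_eq h3, ratio_of_ne h0, hcsq, pv_zero, hs0]
  field_simp

/-- Case `n = N e₂`: `s_n(t) = ψ_N(t)` for `0 < |t| < 1/2`. [cite: FederbushWilliamson1987PhaseCellII, (6.6) p. 1418] -/
theorem sTerm_eq_phiB {t : ℝ} (ht0 : t ≠ 0) (ht : |t| < 1 / 2) {n : Idx} (h0 : n 0 = 0)
    (h1 : n 1 ≠ 0) (h2 : n 2 = 0) (h3 : n 3 = 0) : sTerm n t = phiB (n 1) t := by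
  have hp := pv_mem_U ht
  have hs1 : shift (pv t) n 1 = (t : ℂ) * I + 2 * π * (n 1 : ℂ) := by simp [shift_pv]
  have hsh : shift (pv t) n 1 ≠ 0 := shift_ne_zero hp h1
  rw [hs1] at hsh
  have hτ : (t : ℂ) ≠ 0 := by exact_mod_cast ht0
  have hcsq : csq (shift (pv t) n) = (t : ℂ) ^ 2 + ((t : ℂ) * I + 2 * π * (n 1 : ℂ)) ^ 2 := by
    simp [csq, Fin.sum_univ_four, shift_pv, h0, h2, h3]
  have hcsq_ne : csq (shift (pv t) n) ≠ 0 := csq_shift_ne_zero hp (fun h => h1 (by simp [h]))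
  rw [hcsq] at hcsq_ne
  unfold sTerm termD phiB
  rw [Fin.prod_univ_four, ratio_of_eq h0, ratio_of_eq h2, ratio_of_eq h3, ratio_of_ne h1, hcsq, pv_one, hs1]
  have hI : ((t : ℂ) * I) ^ 2 = -(t : ℂ) ^ 2 := by rw [mul_pow, Complex.I_sq]; ring
  rw [hI]
  field_simp
  ring

/-- Case `n = N e₁`: `s_n(t) → (2πN)⁻⁴ = L(n)`. [cite: FederbushWilliamson1987PhaseCellII, (6.6), (6.14) p. 1418] -/
theorem tendsto_sTerm_axisA {n : Idx} (h0 : n 0 ≠ 0) (h1 : n 1 = 0) (h2 : n 2 = 0) (h3 : n 3 = 0) :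
    Tendsto (sTerm n) (𝓝[≠] 0) (𝓝 (Lcoef n : ℂ)) := by
  have hL : (Lcoef n : ℂ) = phiA (n 0) 0 := by
    rw [phiA_zero h0]; unfold Lcoef; simp [h1, h2, h3]
  rw [hL]
  have h := ((continuousAt_phiA h0).tendsto).mono_left (nhdsWithin_le_nhds (s := {(0:ℝ)}ᶜ))
  refine h.congr' ?_
  filter_upwards [eventually_small] with t ht
  exact (sTerm_eq_phiA ht.1 ht.2 h0 h1 h2 h3).symm

/-- Case `n = N e₂`: `s_n(t) → (2πN)⁻⁴ = L(n)`. [cite: FederbushWilliamson1987PhaseCellII, (6.6), (6.14) p. 1418] -/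
theorem tendsto_sTerm_axisB {n : Idx} (h0 : n 0 = 0) (h1 : n 1 ≠ 0) (h2 : n 2 = 0) (h3 : n 3 = 0) :
    Tendsto (sTerm n) (𝓝[≠] 0) (𝓝 (Lcoef n : ℂ)) := by
  have hL : (Lcoef n : ℂ) = phiB (n 1) 0 := by
    rw [phiB_zero h1]; unfold Lcoef; simp [h0, h1, h2, h3]
  rw [hL]
  have h := ((continuousAt_phiB h1).tendsto).mono_left (nhdsWithin_le_nhds (s := {(0:ℝ)}ᶜ))
  refine h.congr' ?_
  filter_upwards [eventually_small] with t ht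
  exact (sTerm_eq_phiB ht.1 ht.2 h0 h1 h2 h3).symm

/-- **Pointwise limits** `s_n(t) → L(n)` for every `n ≠ 0`. [cite: FederbushWilliamson1987PhaseCellII, (6.6), (6.14) p. 1418] -/
theorem tendsto_sTerm {n : Idx} (hn : n ≠ 0) : Tendsto (sTerm n) (𝓝[≠] 0) (𝓝 (Lcoef n : ℂ)) := by
  by_cases hA : n 2 ≠ 0 ∨ n 3 ≠ 0
  · rw [Lcoef_eq_zero_of_ne hA, Complex.ofReal_zero]
    exact tendsto_const_nhds.congr' (Eventually.of_forall fun t => (sTerm_eq_zero_of_ne hA t).symm)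
  · simp only [not_or, not_not] at hA
    obtain ⟨h2, h3⟩ := hA
    by_cases h0 : n 0 = 0
    · by_cases h1 : n 1 = 0
      · exact absurd (funext fun i => by fin_cases i <;> assumption) hn
      · exact tendsto_sTerm_axisB h0 h1 h2 h3
    · by_cases h1 : n 1 = 0
      · exact tendsto_sTerm_axisA h0 h1 h2 h3
      · exact tendsto_sTerm_both ⟨h2, h3⟩ h0 h1

/-! ## The cone limit -/

/-- (plumbing) on `0 < |t| < 1/2` the difference quotient is the sum of the `s_n(t)`.
[cite: FederbushWilliamson1987PhaseCellII, (6.5)–(6.6) p. 1418] -/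
theorem quotient_eq_tsum {t : ℝ} (ht : |t| < 1 / 2) :
    (D 1 (pv t) - D 0 (pv t)) / (t : ℂ) ^ 2 = ∑' n : NZ, sTerm n.1 t := by
  have hp := pv_mem_U ht
  unfold D sTerm
  rw [← (summable_termD hp 1).tsum_sub (summable_termD hp 0), ← tsum_div_const]

/-- **THE CONE LIMIT**: `(D₂ − D₁)(t(1,i,0,0))/t² → ℓ = 2Σ_{N≠0}(2πN)⁻⁴` as `t → 0`, `t ≠ 0` — the leading behaviour of
`g/t⁴` on the light cone, where the printed (6.12) would require `0`. [cite: FederbushWilliamson1987PhaseCellII, (6.12),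
(6.14) p. 1418] -/
theorem tendsto_cone :
    Tendsto (fun t : ℝ => (D 1 (pv t) - D 0 (pv t)) / (t : ℂ) ^ 2) (𝓝[≠] 0) (𝓝 (ell : ℂ)) := by
  have hlim := tendsto_tsum_of_dominated_convergence (𝓕 := 𝓝[≠] (0 : ℝ))
    (f := fun (t : ℝ) (n : NZ) => sTerm n.1 t) (g := fun n : NZ => (Lcoef n.1 : ℂ))
    (bound := fun n : NZ => u n.1 / 12) (summable_u_NZ.div_const 12) (fun n => tendsto_sTerm n.2)
    (by filter_upwards [eventually_small] with t ht n using norm_sTerm_le ht.1 ht.2 n.2)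
  have hell : (ell : ℂ) = ∑' n : NZ, (Lcoef n.1 : ℂ) := by
    unfold ell; exact Complex.ofReal_tsum _
  rw [hell]
  refine hlim.congr' ?_
  filter_upwards [eventually_small] with t ht
  exact (quotient_eq_tsum ht.2).symm

end ModeAnalyticityConeLimit

end Literature.MathematicalPhysics.QuantumFieldTheory.Federbush1986
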